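import Literature.AlgebraicGeometry.Resolution.DecompletionZoomRings
import Literature.AlgebraicGeometry.Resolution.DecompletionEtalePair
import Mathlib.Algebra.Polynomial.Taylor
import Mathlib.Algebra.Polynomial.HasseDeriv
import Mathlib.FieldTheory.PrimitiveElement
import Mathlib.RingTheory.Polynomial.Subring
import HarnessLib

/-!
# Temkin's decompletion lemma, algebraic proof — VI. The Hensel chart `D₀`

Topic: `Literature/AlgebraicGeometry/Resolution`. M. Temkin, *Inseparable local uniformization*,
J. Algebra 373 (2013) 65–119 = arXiv:0804.1554v3, Lemma 3.3.2 (tree: `Temkin2013_Lemma332_nft`).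

For the chart `C : DecompChart V O A φ` and its zoom rings `A′_j ≤ A″₀ ≤ K`
(`DecompletionZoomRings.lean`) this file constructs the `K`-side half of the common smooth roof:
an explicit ÉTALE `A″_j`-algebra `D₀` in which the minimal polynomial `p` of a primitive integral
element `y₀ = y(x)` of `m/k` acquires a root `ζ` close to `y` — the finite-level replacement of
"`m̂ ⊂ 𝒪(𝔛′_η)`" (Hensel's lemma in the completion) in Temkin's proof (p. 45).

* Hensel base (`exists_y`, `y`, `y₀`, `p`, `py = p(y)`, `ay = p′(y)`, `Na, ra, ba, bp, jH`, the
  unit `t` with `a_y · ra = π^{N_a} t`, the ring `A″_j = A″₀[1/t]`, `ι = ra/t` with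
  `a_y ι = π^{N_a}`, `γ_p` with `π^{b_p} p(y) = π^j γ_p`, `γ_p(x) = 0`) — PROVED;
* the zoomed Hensel polynomial `p_new(Z) = ι² π^{−e−2N_a} p(y + π^e a_y Z)` over `K`
  (`pnewK`, `C_mul_pnewK`, its coefficients `coeff_pnewK_zero/one/of_two_le`, all in `A″_j`)
  and over `A″_j` (`pS`, `pnewS`, `C_mul_pnewS`) — PROVED;
* `D₀ = (A″_j[Z]/(p_new))[1/(p_new′ · (p_new − p_new(0))/Z)]` as an `EtalePair` ring, its
  `m°`-point `σ_D` (`hasMap_zero`), the prime `r_D`, the root `ζ = y + δZ` of `p`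
  (`aeval_ζ_pS`, by flatness), the smallness `Z ∈ π^{j−b_p−e−2N_a} D₀` (`Z_small`), and the
  point as a ring homomorphism `σDr` with `σDr_Z`, `σDr_algebraMap`, `σDr_ζ` — PROVED.

All statements are [folklore]; no named facts.

## Sources

* M. Temkin, arXiv:0804.1554v3, proof of Lemma 3.3.2 (pp. 45–46).
-/

noncomputable section

open Polynomial

namespace Literature.AlgebraicGeometry.Resolution

universe u

variable {k K m : Type u} [Field k] [Field K] [Algebra k K] [Field m] [Algebra k m]


/-! ### The Hensel base: a primitive integral element and its minimal polynomial -/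

section EvPoly

variable {A : Subring K} (φ : Algebra.adjoin k (A : Set K) →ₐ[k] m)

/-- The value at the point commutes with evaluation of `k`-polynomials on the local ring.
[folklore] -/
theorem ev_aeval {z : K} (hz : z ∈ Rx φ) (q : k[X]) :
    ev φ (Polynomial.aeval z q) = Polynomial.aeval (ev φ z) q := by
  rw [Polynomial.aeval_eq_sum_range, Polynomial.aeval_eq_sum_range, ev_sum φ]
  · refine Finset.sum_congr rfl fun i _ => ?_
    rw [Algebra.smul_def, Algebra.smul_def, ev_mul φ ((Rx φ).algebraMap_mem _) ((Rx φ).pow_mem hz i),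
      ev_algebraMap φ, ev_pow φ hz]
  · intro i _
    rw [Algebra.smul_def]
    exact (Rx φ).mul_mem ((Rx φ).algebraMap_mem _) ((Rx φ).pow_mem hz i)

end EvPoly

namespace DecompChart

variable {V : ValuationSubring k} {O : ValuationSubring m} {A : Subring K}
  {φ : Algebra.adjoin k (A : Set K) →ₐ[k] m} (C : DecompChart V O A φ)

/-- Evaluating a `k`-polynomial with `k°`-coefficients at an element of `A₀` stays in `A₀`.
[folklore] -/
theorem aeval_mem_A₀ {z : K} (hz : z ∈ C.A₀) {q : k[X]} (hq : ∀ i, q.coeff i ∈ V) :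
    Polynomial.aeval z q ∈ C.A₀ := by
  rw [Polynomial.aeval_eq_sum_range]
  refine Subring.sum_mem _ fun i _ => ?_
  rw [Algebra.smul_def]
  exact Subring.mul_mem _ (C.algebraMap_mem_A₀ (hq i)) (Subring.pow_mem _ hz i)

/-- **A primitive integral element of `m/k` realized on the model**: there is `y ∈ A₀ = k°[f]`
whose value `y₀ = y(x)` is integral over `k°` and generates `m` over `k` (primitive element
theorem for the finite separable `m/k`, surjectivity of `φ`, and scaling by powers of `π`).
[folklore] -/
theorem exists_y : ∃ y ∈ C.A₀, IsIntegral (V.toSubring.map (algebraMap k m)) (ev φ y) ∧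
    IntermediateField.adjoin k {ev φ y} = ⊤ := by
  haveI := C.hfin
  haveI := C.hsepm
  haveI : Algebra.IsAlgebraic k m := Algebra.IsAlgebraic.of_finite k m
  obtain ⟨θ, hθ⟩ := Field.exists_primitive_element k m
  obtain ⟨r, hr⟩ := C.hφsurj θ
  obtain ⟨N₁, hN₁⟩ := C.hden r r.2
  obtain ⟨N₂, hN₂⟩ := exists_pow_mul_isIntegral V C.hdim C.hπV C.hπlt
    (algebraMap k m C.π ^ N₁ * θ)
  refine ⟨C.πK ^ N₂ * (C.πK ^ N₁ * r), Subring.mul_mem _ (Subring.pow_mem _ C.πK_mem_A₀ _) hN₁,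
    ?_, ?_⟩
  · have hev : ev φ (C.πK ^ N₂ * (C.πK ^ N₁ * r)) =
        algebraMap k m C.π ^ N₂ * (algebraMap k m C.π ^ N₁ * θ) := by
      have hπ : C.πK ∈ Rx φ := C.A₀_subset_Rx C.πK_mem_A₀
      rw [ev_mul φ ((Rx φ).pow_mem hπ _) ((Rx φ).mul_mem ((Rx φ).pow_mem hπ _) (R_le_Rx φ r.2)),
        ev_mul φ ((Rx φ).pow_mem hπ _) (R_le_Rx φ r.2), ev_pow φ hπ, ev_pow φ hπ, C.ev_πK,
        ev_eq_φ φ r.2, ← hr]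
    rw [hev]; exact hN₂
  · -- `c θ` generates as well as `θ` for a non-zero constant `c`
    have hc : algebraMap k m C.π ^ N₂ * algebraMap k m C.π ^ N₁ ≠ 0 :=
      mul_ne_zero (pow_ne_zero _ C.π_ne_zero_m) (pow_ne_zero _ C.π_ne_zero_m)
    have hev : ev φ (C.πK ^ N₂ * (C.πK ^ N₁ * r)) =
        (algebraMap k m C.π ^ N₂ * algebraMap k m C.π ^ N₁) * θ := by
      have hπ : C.πK ∈ Rx φ := C.A₀_subset_Rx C.πK_mem_A₀
      rw [ev_mul φ ((Rx φ).pow_mem hπ _) ((Rx φ).mul_mem ((Rx φ).pow_mem hπ _) (R_le_Rx φ r.2)),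
        ev_mul φ ((Rx φ).pow_mem hπ _) (R_le_Rx φ r.2), ev_pow φ hπ, ev_pow φ hπ, C.ev_πK,
        ev_eq_φ φ r.2, mul_assoc, ← hr]
    rw [hev]
    refine top_le_iff.mp (hθ ▸ ?_)
    refine IntermediateField.adjoin_le_iff.mpr ?_
    intro z hz
    rw [Set.mem_singleton_iff] at hz
    rw [hz]
    set c := algebraMap k m C.π ^ N₂ * algebraMap k m C.π ^ N₁ with hcdef
    have hcθ : c * θ ∈ IntermediateField.adjoin k {c * θ} :=
      IntermediateField.subset_adjoin _ _ (Set.mem_singleton _)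
    have hcinv : c⁻¹ ∈ IntermediateField.adjoin k {c * θ} :=
      inv_mem (mul_mem (pow_mem (IntermediateField.algebraMap_mem _ _) _)
        (pow_mem (IntermediateField.algebraMap_mem _ _) _))
    have key := mul_mem hcinv hcθ
    rwa [← mul_assoc, inv_mul_cancel₀ hc, one_mul] at key

/-- The Hensel base `y ∈ A₀`. [folklore] -/
def y : K := C.exists_y.choose

/-- `y ∈ A₀`. [folklore] -/
theorem y_mem_A₀ : C.y ∈ C.A₀ := C.exists_y.choose_spec.1

/-- `y ∈ Rx`. [folklore] -/
theorem y_mem_Rx : C.y ∈ Rx φ := C.A₀_subset_Rx C.y_mem_A₀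

/-- The value `y₀ = y(x) ∈ m`. [folklore] -/
def y₀ : m := ev φ C.y

/-- `y₀` is integral over `k°`. [folklore] -/
theorem y₀_isIntegral : IsIntegral (V.toSubring.map (algebraMap k m)) C.y₀ :=
  C.exists_y.choose_spec.2.1

/-- `y₀` generates `m` over `k`. [folklore] -/
theorem adjoin_y₀ : IntermediateField.adjoin k {C.y₀} = ⊤ := C.exists_y.choose_spec.2.2

/-- The minimal polynomial `p` of `y₀` over `k`. [folklore] -/
def p : k[X] := minpoly k C.y₀

/-- `p` has coefficients in `k°`. [folklore] -/
theorem coeff_p_mem (i : ℕ) : C.p.coeff i ∈ V := coeff_minpoly_mem_of_isIntegral V C.y₀_isIntegral i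

/-- `p(y₀) = 0`. [folklore] -/
theorem aeval_y₀_p : Polynomial.aeval C.y₀ C.p = 0 := minpoly.aeval k _

/-- `p` is separable (`m/k` separable). [folklore] -/
theorem p_separable : C.p.Separable := by
  haveI := C.hsepm
  exact Algebra.IsSeparable.isSeparable k C.y₀

/-- `p(y) ∈ A₀`. [folklore] -/
def py : K := Polynomial.aeval C.y C.p

/-- `p(y) ∈ A₀`. [folklore] -/
theorem py_mem_A₀ : C.py ∈ C.A₀ := C.aeval_mem_A₀ C.y_mem_A₀ C.coeff_p_mem

/-- `p(y)` vanishes at the point. [folklore] -/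
theorem ev_py : ev φ C.py = 0 := by
  rw [py, ev_aeval φ C.y_mem_Rx]; exact C.aeval_y₀_p

/-- `a_y = p′(y) ∈ A₀`. [folklore] -/
def ay : K := Polynomial.aeval C.y (derivative C.p)

/-- `a_y ∈ A₀`. [folklore] -/
theorem ay_mem_A₀ : C.ay ∈ C.A₀ :=
  C.aeval_mem_A₀ C.y_mem_A₀ (fun i => by
    rw [Polynomial.coeff_derivative, ← Nat.cast_succ]
    exact mul_mem (C.coeff_p_mem _) (natCast_mem V _))

/-- `a_y(x) = p′(y₀) ≠ 0` (separability). [folklore] -/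
theorem ev_ay_ne_zero : ev φ C.ay ≠ 0 := by
  rw [ay, ev_aeval φ C.y_mem_Rx]
  exact C.p_separable.aeval_derivative_ne_zero C.aeval_y₀_p

/-! #### The constants of the Hensel chart -/

/-- Inversion of `a_y` up to `π^{N_a}` (from `exists_mul_eq_pow_mul_unit`). [folklore] -/
theorem exists_Na : ∃ (N : ℕ) (r : K), r ∈ C.A₀ ∧ ∃ b : ℕ,
    ∀ (j : ℕ) (hj : C.j₀ ≤ j), b + N + 1 ≤ j → ∃ t ∈ C.A''₀ hj, C.ay * r = C.πK ^ N * t ∧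
      ∃ ht : ev φ t ∈ O, IsUnit (⟨ev φ t, ht⟩ : O) :=
  C.exists_mul_eq_pow_mul_unit (Algebra.subset_adjoin (C.A₀_le_A C.ay_mem_A₀)) C.ev_ay_ne_zero

/-- `N_a`. [folklore] -/
def Na : ℕ := C.exists_Na.choose

/-- `r_a` (an element of `A₀`, see `ra_mem_A₀`). [folklore] -/
def ra : K := C.exists_Na.choose_spec.choose

/-- `r_a ∈ A₀`. [folklore] -/
theorem ra_mem_A₀ : C.ra ∈ C.A₀ := C.exists_Na.choose_spec.choose_spec.1

/-- `b_a`. [folklore] -/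
def ba : ℕ := C.exists_Na.choose_spec.choose_spec.2.choose

/-- The specification of `N_a, r_a, b_a`. [folklore] -/
theorem spec_Na (j : ℕ) (hj : C.j₀ ≤ j) (hb : C.ba + C.Na + 1 ≤ j) :
    ∃ t ∈ C.A''₀ hj, C.ay * C.ra = C.πK ^ C.Na * t ∧ ∃ ht : ev φ t ∈ O, IsUnit (⟨ev φ t, ht⟩ : O) :=
  C.exists_Na.choose_spec.choose_spec.2.choose_spec j hj hb

/-- Linear smallness of `p(y)` (from `exists_small`). [folklore] -/
theorem exists_bp : ∃ b : ℕ, ∀ (j : ℕ) (hj : C.j₀ ≤ j), b ≤ j →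
    ∃ γ ∈ C.A''₀ hj, C.πK ^ b * C.py = C.πK ^ j * γ :=
  C.exists_small (C.A₀_subset_Rh C.py_mem_A₀) C.ev_py

/-- `b_p`. [folklore] -/
def bp : ℕ := C.exists_bp.choose

/-- The specification of `b_p`. [folklore] -/
theorem spec_bp (j : ℕ) (hj : C.j₀ ≤ j) (hb : C.bp ≤ j) :
    ∃ γ ∈ C.A''₀ hj, C.πK ^ C.bp * C.py = C.πK ^ j * γ :=
  C.exists_bp.choose_spec j hj hb

/-- The threshold of the Hensel chart (before the `e`-shift): `j ≥ jH` guarantees all the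
above. [folklore] -/
def jH : ℕ := max C.j₀ (max (C.ba + C.Na + 1) C.bp)

/-- `j₀ ≤ jH`. [folklore] -/
theorem j₀_le_jH : C.j₀ ≤ C.jH := le_max_left _ _

/-- `ba + Na + 1 ≤ jH`. [folklore] -/
theorem ba_le_jH : C.ba + C.Na + 1 ≤ C.jH := le_trans (le_max_left _ _) (le_max_right _ _)

/-- `bp ≤ jH`. [folklore] -/
theorem bp_le_jH : C.bp ≤ C.jH := le_trans (le_max_right _ _) (le_max_right _ _)

/-! #### The second localization `A″_j = A″₀_j[1/t]` -/

/-- The unit-valued element `t_j` with `a_y r_a = π^{N_a} t_j`. [folklore] -/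
def t {j : ℕ} (hj : C.jH ≤ j) : K :=
  (C.spec_Na j (le_trans C.j₀_le_jH hj) (le_trans C.ba_le_jH hj)).choose

/-- `t_j ∈ A″₀_j`. [folklore] -/
theorem t_mem_A''₀ {j : ℕ} (hj : C.jH ≤ j) : C.t hj ∈ C.A''₀ (le_trans C.j₀_le_jH hj) :=
  (C.spec_Na j (le_trans C.j₀_le_jH hj) (le_trans C.ba_le_jH hj)).choose_spec.1

/-- `a_y r_a = π^{N_a} t_j`. [folklore] -/
theorem ay_mul_ra {j : ℕ} (hj : C.jH ≤ j) : C.ay * C.ra = C.πK ^ C.Na * C.t hj :=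
  (C.spec_Na j (le_trans C.j₀_le_jH hj) (le_trans C.ba_le_jH hj)).choose_spec.2.1

/-- `t_j(x) ∈ O`. [folklore] -/
theorem ev_t_mem_O {j : ℕ} (hj : C.jH ≤ j) : ev φ (C.t hj) ∈ O :=
  (C.spec_Na j (le_trans C.j₀_le_jH hj) (le_trans C.ba_le_jH hj)).choose_spec.2.2.choose

/-- `t_j(x)` is a unit of `O`. [folklore] -/
theorem isUnit_ev_t {j : ℕ} (hj : C.jH ≤ j) : IsUnit (⟨ev φ (C.t hj), C.ev_t_mem_O hj⟩ : O) :=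
  (C.spec_Na j (le_trans C.j₀_le_jH hj) (le_trans C.ba_le_jH hj)).choose_spec.2.2.choose_spec

/-- `t_j(x) ≠ 0`. [folklore] -/
theorem ev_t_ne_zero {j : ℕ} (hj : C.jH ≤ j) : ev φ (C.t hj) ≠ 0 := fun h0 => by
  have hu := C.isUnit_ev_t hj
  have : (⟨ev φ (C.t hj), C.ev_t_mem_O hj⟩ : O) = 0 := Subtype.ext h0
  rw [this] at hu
  exact not_isUnit_zero hu

/-- `t_j ≠ 0`. [folklore] -/
theorem t_ne_zero {j : ℕ} (hj : C.jH ≤ j) : C.t hj ≠ 0 := fun h0 =>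
  C.ev_t_ne_zero hj (by rw [h0, ev_zero φ])

/-- **The base ring of the Hensel chart** `A″_j = A′_j[1/(s·sh)][1/t_j] ⊆ K`: a neighbourhood
of the centre of `m°` on `X′` on which `s`, `h` are units and `a_y` divides `π^{N_a}`.
[folklore] -/
def A'' {j : ℕ} (hj : C.jH ≤ j) : Subring K :=
  awaySubring (C.A''₀ (le_trans C.j₀_le_jH hj)) (C.t hj) (C.t_mem_A''₀ hj)

/-- `A″₀_j ≤ A″_j`. [folklore] -/
theorem A''₀_le_A'' {j : ℕ} (hj : C.jH ≤ j) : C.A''₀ (le_trans C.j₀_le_jH hj) ≤ C.A'' hj :=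
  le_awaySubring _ _ _

/-- `A″_j ⊆ Rx`. [folklore] -/
theorem A''_subset_Rx {j : ℕ} (hj : C.jH ≤ j) {z : K} (hz : z ∈ C.A'' hj) : z ∈ Rx φ :=
  awaySubring_subset_Rx φ (fun _ hw => C.A''₀_subset_Rx _ hw) (C.t_mem_A''₀ hj)
    (C.ev_t_ne_zero hj) hz

/-- Values of elements of `A″_j` lie in `O` (divide by the unit `t(x)ᴺ` of `O`). [folklore] -/
theorem ev_mem_O_of_mem_A'' {j : ℕ} (hj : C.jH ≤ j) {z : K} (hz : z ∈ C.A'' hj) : ev φ z ∈ O := by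
  obtain ⟨N, hN⟩ := mem_awaySubring_iff.mp hz
  have h1 : ev φ (C.t hj ^ N * z) ∈ O := C.ev_mem_O_of_mem_A''₀ _ hN
  have htRx : C.t hj ∈ Rx φ := C.A''₀_subset_Rx _ (C.t_mem_A''₀ hj)
  rw [ev_mul φ ((Rx φ).pow_mem htRx N) (C.A''_subset_Rx hj hz), ev_pow φ htRx] at h1
  have hinvO : (ev φ (C.t hj))⁻¹ ∈ O :=
    inv_mem_valuationSubring_of_valuation_eq_one
      ((ValuationSubring.valuation_eq_one_iff O _).mp (C.isUnit_ev_t hj))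
  have : ev φ z = (ev φ (C.t hj) ^ N * ev φ z) * (ev φ (C.t hj))⁻¹ ^ N := by
    rw [inv_pow, mul_comm (ev φ (C.t hj) ^ N), mul_assoc,
      mul_inv_cancel₀ (pow_ne_zero N (C.ev_t_ne_zero hj)), mul_one]
  rw [this]
  exact mul_mem h1 (pow_mem hinvO N)

/-- The inverse of `a_y` up to `π^{N_a}`: `ι = r_a / t_j ∈ A″_j` with `a_y ι = π^{N_a}`.
[folklore] -/
def ι {j : ℕ} (hj : C.jH ≤ j) : K := C.ra * (C.t hj)⁻¹

/-- `ι ∈ A″_j`. [folklore] -/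
theorem ι_mem_A'' {j : ℕ} (hj : C.jH ≤ j) : C.ι hj ∈ C.A'' hj :=
  Subring.mul_mem _ (C.A''₀_le_A'' hj (C.A₀_subset_A''₀ _ C.ra_mem_A₀))
    (inv_mem_awaySubring _ (C.t_mem_A''₀ hj) (C.t_ne_zero hj))

/-- `a_y ι = π^{N_a}`. [folklore] -/
theorem ay_mul_ι {j : ℕ} (hj : C.jH ≤ j) : C.ay * C.ι hj = C.πK ^ C.Na := by
  rw [ι, ← mul_assoc, C.ay_mul_ra hj, mul_assoc, mul_inv_cancel₀ (C.t_ne_zero hj), mul_one]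

/-- `π ∈ A″_j`, `A₀ ⊆ A″_j`, `y, a_y ∈ A″_j`. [folklore] -/
theorem A₀_subset_A'' {j : ℕ} (hj : C.jH ≤ j) {z : K} (hz : z ∈ C.A₀) : z ∈ C.A'' hj :=
  C.A''₀_le_A'' hj (C.A₀_subset_A''₀ _ hz)

/-- The small element `γ_p` with `π^{b_p} p(y) = π^j γ_p`. [folklore] -/
def γp {j : ℕ} (hj : C.jH ≤ j) : K :=
  (C.spec_bp j (le_trans C.j₀_le_jH hj) (le_trans C.bp_le_jH hj)).choose

/-- `γ_p ∈ A″₀_j`. [folklore] -/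
theorem γp_mem_A''₀ {j : ℕ} (hj : C.jH ≤ j) : C.γp hj ∈ C.A''₀ (le_trans C.j₀_le_jH hj) :=
  (C.spec_bp j (le_trans C.j₀_le_jH hj) (le_trans C.bp_le_jH hj)).choose_spec.1

/-- `π^{b_p} p(y) = π^j γ_p`. [folklore] -/
theorem pow_mul_py {j : ℕ} (hj : C.jH ≤ j) : C.πK ^ C.bp * C.py = C.πK ^ j * C.γp hj :=
  (C.spec_bp j (le_trans C.j₀_le_jH hj) (le_trans C.bp_le_jH hj)).choose_spec.2

/-- `γ_p(x) = 0` (as `p(y)(x) = p(y₀) = 0` and `π ≠ 0`). [folklore] -/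
theorem ev_γp {j : ℕ} (hj : C.jH ≤ j) : ev φ (C.γp hj) = 0 := by
  have h1 := congrArg (ev φ) (C.pow_mul_py hj)
  have hπ : C.πK ∈ Rx φ := C.A₀_subset_Rx C.πK_mem_A₀
  rw [ev_mul φ ((Rx φ).pow_mem hπ _) (C.A₀_subset_Rx C.py_mem_A₀), C.ev_py, mul_zero,
    ev_mul φ ((Rx φ).pow_mem hπ _) (C.A''₀_subset_Rx _ (C.γp_mem_A''₀ hj)), ev_pow φ hπ,
    C.ev_πK] at h1
  exact (mul_eq_zero.mp h1.symm).resolve_left (pow_ne_zero _ C.π_ne_zero_m)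

end DecompChart

/-! ### Polynomial book-keeping: coefficients in a subring -/

section PolyAux

/-- A polynomial all of whose coefficients lie in a subring evaluates into the subring at
elements of the subring. [folklore] -/
theorem eval_mem_of_coeff_mem_subring {K' : Type*} [CommRing K'] (S : Subring K') {q : K'[X]}
    (hq : ∀ i, q.coeff i ∈ S) {z : K'} (hz : z ∈ S) : q.eval z ∈ S := by
  rw [Polynomial.eval_eq_sum_range]
  exact Subring.sum_mem _ fun i _ => Subring.mul_mem _ (hq i) (Subring.pow_mem _ hz i)

/-- Coefficientwise membership gives the hypothesis of `Polynomial.toSubring`. [folklore] -/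
theorem coeffs_subset_of_coeff_mem {K' : Type*} [CommRing K'] (S : Subring K') {q : K'[X]}
    (hq : ∀ i, q.coeff i ∈ S) : (↑q.coeffs : Set K') ⊆ S := fun a ha => by
  obtain ⟨n, -, rfl⟩ := Polynomial.mem_coeffs_iff.mp ha
  exact hq n

end PolyAux

namespace DecompChart

variable {V : ValuationSubring k} {O : ValuationSubring m} {A : Subring K}
  {φ : Algebra.adjoin k (A : Set K) →ₐ[k] m} (C : DecompChart V O A φ)

/-! ### The minimal polynomial over `K` and its Taylor expansion at `y` -/

/-- `p` pushed to `K[X]`. [folklore] -/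
def pK : K[X] := C.p.map (algebraMap k K)

/-- Coefficients of `pK` lie in `A₀`. [folklore] -/
theorem coeff_pK_mem (i : ℕ) : C.pK.coeff i ∈ C.A₀ := by
  rw [pK, Polynomial.coeff_map]; exact C.algebraMap_mem_A₀ (C.coeff_p_mem i)

/-- `pK(z) = p(z)` (as `k`-algebra evaluation). [folklore] -/
theorem eval_pK (z : K) : C.pK.eval z = Polynomial.aeval z C.p := by
  rw [pK, Polynomial.eval_map, Polynomial.aeval_def]

/-- The Taylor expansion `PT` of `pK` at `y`. [folklore] -/
def PT : K[X] := Polynomial.taylor C.y C.pK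

/-- `PT₀ = p(y)`. [folklore] -/
theorem PT_coeff_zero : C.PT.coeff 0 = C.py := by
  rw [PT, Polynomial.taylor_coeff_zero, C.eval_pK]; rfl

/-- `PT₁ = p′(y) = a_y`. [folklore] -/
theorem PT_coeff_one : C.PT.coeff 1 = C.ay := by
  rw [PT, Polynomial.taylor_coeff_one, pK, Polynomial.derivative_map, Polynomial.eval_map,
    ← Polynomial.aeval_def]; rfl

/-- All Taylor coefficients lie in `A₀`. [folklore] -/
theorem PT_coeff_mem (n : ℕ) : C.PT.coeff n ∈ C.A₀ := by
  rw [PT, Polynomial.taylor_coeff]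
  refine eval_mem_of_coeff_mem_subring C.A₀ (fun i => ?_) C.y_mem_A₀
  rw [Polynomial.hasseDeriv_coeff]
  exact Subring.mul_mem _ (natCast_mem C.A₀ _) (C.coeff_pK_mem _)

/-- `pK(y + W) = PT(W)`: `pK ∘ (y + δ X) = PT ∘ (δ X)`. [folklore] -/
theorem pK_comp (δ : K) : C.pK.comp (Polynomial.C C.y + Polynomial.C δ * X) =
    C.PT.comp (Polynomial.C δ * X) := by
  rw [PT, Polynomial.taylor_apply, Polynomial.comp_assoc, Polynomial.add_comp, Polynomial.X_comp,
    Polynomial.C_comp, add_comm]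

/-! ### The zoomed Hensel polynomial `p_new` over `K` -/

section Pnew

variable (e : ℕ) {j : ℕ} (hj : C.jH ≤ j)

/-- The zoom scale `δ = π^e a_y` of the Hensel variable. [folklore] -/
def δ : K := C.πK ^ e * C.ay

/-- **The zoomed Hensel polynomial** `p_new(Z) = ι²/π^{e+2N_a} · p(y + δ Z) ∈ K[Z]` — the
strong-Hensel normalization of `p` at the approximate root `y` (`|p(y)| < |p′(y)|²` on the deep
zoom rings): its constant coefficient is `π`-adically small, its linear coefficient is `1`, and
its higher coefficients are integral. [folklore] -/
def pnewK : K[X] :=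
  Polynomial.C (C.ι hj ^ 2 * (C.πK ^ (e + 2 * C.Na))⁻¹) *
    C.pK.comp (Polynomial.C C.y + Polynomial.C (C.δ e) * X)

/-- The defining identity `π^{e+2N_a} · p_new = ι² · p(y + δZ)` over `K`. [folklore] -/
theorem C_mul_pnewK : Polynomial.C (C.πK ^ (e + 2 * C.Na)) * C.pnewK e hj =
    Polynomial.C (C.ι hj ^ 2) * C.pK.comp (Polynomial.C C.y + Polynomial.C (C.δ e) * X) := by
  rw [pnewK, ← mul_assoc, ← Polynomial.C_mul]
  congr 2
  rw [mul_left_comm, mul_inv_cancel₀ (pow_ne_zero _ C.πK_ne_zero), mul_one]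

/-- The coefficients of `p_new`: `(p_new)_n = PT_n δⁿ ι² / π^{e+2N_a}`. [folklore] -/
theorem coeff_pnewK (n : ℕ) : (C.pnewK e hj).coeff n =
    C.PT.coeff n * C.δ e ^ n * (C.ι hj ^ 2 * (C.πK ^ (e + 2 * C.Na))⁻¹) := by
  rw [pnewK, Polynomial.coeff_C_mul, C.pK_comp, Polynomial.comp_C_mul_X_coeff]; ring

/-- `(p_new)₁ = 1` (this is what the scale `δ = π^e a_y` and the factor `ι²/π^{e+2N_a}` are for:
`a_y δ ι² = π^e (a_y ι)² = π^{e+2N_a}`). [folklore] -/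
theorem coeff_pnewK_one : (C.pnewK e hj).coeff 1 = 1 := by
  rw [C.coeff_pnewK, C.PT_coeff_one, pow_one, δ]
  have hι := C.ay_mul_ι hj
  have hπ : C.πK ^ (e + 2 * C.Na) ≠ 0 := pow_ne_zero _ C.πK_ne_zero
  field_simp
  rw [pow_add, pow_mul', ← hι]; ring

/-- `(p_new)_n = PT_n π^{e(n-1)} a_y^{n-2}` for `n ≥ 2` — integral. [folklore] -/
theorem coeff_pnewK_of_two_le {n : ℕ} (hn : 2 ≤ n) : (C.pnewK e hj).coeff n =
    C.PT.coeff n * C.πK ^ (e * (n - 1)) * C.ay ^ (n - 2) := by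
  rw [C.coeff_pnewK, δ]
  have hι := C.ay_mul_ι hj
  have hπ : C.πK ^ (e + 2 * C.Na) ≠ 0 := pow_ne_zero _ C.πK_ne_zero
  obtain ⟨n', rfl⟩ : ∃ n', n = n' + 2 := ⟨n - 2, by omega⟩
  simp only [Nat.add_sub_cancel, show n' + 2 - 1 = n' + 1 by omega]
  field_simp
  rw [show C.πK ^ (e + 2 * C.Na) = C.πK ^ e * (C.ay * C.ι hj) ^ 2 by rw [pow_add, pow_mul', ← hι]]
  ring

/-- `(p_new)₀ = π^{j - b_p - e - 2N_a} γ_p ι²` (the `π`-adically small constant term), for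
`j ≥ b_p + e + 2 N_a`. [folklore] -/
theorem coeff_pnewK_zero (hje : C.bp + e + 2 * C.Na ≤ j) : (C.pnewK e hj).coeff 0 =
    C.πK ^ (j - C.bp - e - 2 * C.Na) * C.γp hj * C.ι hj ^ 2 := by
  rw [C.coeff_pnewK, C.PT_coeff_zero, pow_zero, mul_one]
  have hpy := C.pow_mul_py hj
  have hπ0 := C.πK_ne_zero
  -- `py = π^{j-bp} γp`
  have hpy' : C.py = C.πK ^ (j - C.bp) * C.γp hj := by
    apply mul_left_cancel₀ (pow_ne_zero C.bp hπ0)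
    rw [hpy, ← mul_assoc, ← pow_add, Nat.add_sub_cancel' (le_trans C.bp_le_jH hj)]
  rw [hpy']
  obtain ⟨N₀, hN₁, hN₂⟩ : ∃ N₀, j - C.bp - e - 2 * C.Na = N₀ ∧ j - C.bp = N₀ + (e + 2 * C.Na) :=
    ⟨j - C.bp - e - 2 * C.Na, rfl, by omega⟩
  rw [hN₁, hN₂, pow_add]
  field_simp

/-- All coefficients of `p_new` lie in `A″_j` (for `j ≥ b_p + e + 2N_a`). [folklore] -/
theorem coeff_pnewK_mem (hje : C.bp + e + 2 * C.Na ≤ j) (n : ℕ) : (C.pnewK e hj).coeff n ∈ C.A'' hj := by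
  rcases Nat.lt_or_ge n 2 with hn | hn
  · interval_cases n
    · rw [C.coeff_pnewK_zero e hj hje]
      exact Subring.mul_mem _ (Subring.mul_mem _ (Subring.pow_mem _ (C.A₀_subset_A'' hj C.πK_mem_A₀) _)
        (C.A''₀_le_A'' hj (C.γp_mem_A''₀ hj))) (Subring.pow_mem _ (C.ι_mem_A'' hj) _)
    · rw [C.coeff_pnewK_one]; exact Subring.one_mem _
  · rw [C.coeff_pnewK_of_two_le e hj hn]
    exact Subring.mul_mem _ (Subring.mul_mem _ (C.A₀_subset_A'' hj (C.PT_coeff_mem n))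
      (Subring.pow_mem _ (C.A₀_subset_A'' hj C.πK_mem_A₀) _)) (Subring.pow_mem _ (C.A₀_subset_A'' hj C.ay_mem_A₀) _)

end Pnew

/-! ### Transfer to the base ring `A″_j` of the Hensel chart -/

section OverS

variable (e : ℕ) {j : ℕ} (hj : C.jH ≤ j) (hje : C.bp + e + 2 * C.Na ≤ j)

/-- `p` over `A″_j`. [folklore] -/
def pS : (C.A'' hj)[X] :=
  C.pK.toSubring (C.A'' hj) (coeffs_subset_of_coeff_mem _ fun i => C.A₀_subset_A'' hj (C.coeff_pK_mem i))

/-- `pS` maps to `pK`. [folklore] -/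
theorem map_pS : (C.pS hj).map (C.A'' hj).subtype = C.pK := Polynomial.map_toSubring _ _ _

include hje in
/-- `p_new` over `A″_j`. [folklore] -/
def pnewS : (C.A'' hj)[X] :=
  (C.pnewK e hj).toSubring (C.A'' hj) (coeffs_subset_of_coeff_mem _ (C.coeff_pnewK_mem e hj hje))

/-- `pnewS` maps to `pnewK`. [folklore] -/
theorem map_pnewS : (C.pnewS e hj hje).map (C.A'' hj).subtype = C.pnewK e hj := Polynomial.map_toSubring _ _ _

/-- The elements of the base ring entering the identity. [folklore] -/
def yS : C.A'' hj := ⟨C.y, C.A₀_subset_A'' hj C.y_mem_A₀⟩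

/-- `δ` in `A″_j`. [folklore] -/
def δS : C.A'' hj := ⟨C.δ e, Subring.mul_mem _ (Subring.pow_mem _ (C.A₀_subset_A'' hj C.πK_mem_A₀) _)
  (C.A₀_subset_A'' hj C.ay_mem_A₀)⟩

/-- `ι` in `A″_j`. [folklore] -/
def ιS : C.A'' hj := ⟨C.ι hj, C.ι_mem_A'' hj⟩

/-- `π` in `A″_j`. [folklore] -/
def πS : C.A'' hj := ⟨C.πK, C.A₀_subset_A'' hj C.πK_mem_A₀⟩

/-- **The Hensel identity over the base ring**:
`π^{e+2N_a} · p_new = ι² · p ∘ (y + δ X)` in `A″_j[X]`. [folklore] -/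
theorem C_mul_pnewS : Polynomial.C (C.πS hj ^ (e + 2 * C.Na)) * C.pnewS e hj hje =
    Polynomial.C (C.ιS hj ^ 2) * (C.pS hj).comp (Polynomial.C (C.yS hj) + Polynomial.C (C.δS e hj) * X) := by
  apply Polynomial.map_injective (C.A'' hj).subtype Subtype.val_injective
  have h := C.C_mul_pnewK e hj
  simp only [Polynomial.map_mul, Polynomial.map_C, Polynomial.map_comp,
    Polynomial.map_add, Polynomial.map_X, C.map_pnewS, C.map_pS, Subring.coe_subtype]
  exact h

/-- `(p_new)₁ = 1` over `A″_j`. [folklore] -/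
theorem coeff_pnewS_one : (C.pnewS e hj hje).coeff 1 = 1 := by
  apply Subtype.val_injective
  rw [pnewS, Polynomial.coeff_toSubring', C.coeff_pnewK_one]; rfl

/-- `(p_new)₀` over `A″_j`, in `K`. [folklore] -/
theorem coeff_pnewS_zero_val : ((C.pnewS e hj hje).coeff 0 : K) =
    C.πK ^ (j - C.bp - e - 2 * C.Na) * C.γp hj * C.ι hj ^ 2 := by
  rw [pnewS, Polynomial.coeff_toSubring', C.coeff_pnewK_zero e hj hje]

/-- The value of `(p_new)₀` at the point is `0` (`γ_p(x) = 0`). [folklore] -/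
theorem ev_coeff_pnewS_zero : ev φ ((C.pnewS e hj hje).coeff 0 : K) = 0 := by
  rw [C.coeff_pnewS_zero_val e hj hje]
  have hπ : C.πK ∈ Rx φ := C.A₀_subset_Rx C.πK_mem_A₀
  have hγ : C.γp hj ∈ Rx φ := C.A''₀_subset_Rx _ (C.γp_mem_A''₀ hj)
  have hι : C.ι hj ∈ Rx φ := C.A''_subset_Rx hj (C.ι_mem_A'' hj)
  rw [ev_mul φ ((Rx φ).mul_mem ((Rx φ).pow_mem hπ _) hγ) ((Rx φ).pow_mem hι 2),
    ev_mul φ ((Rx φ).pow_mem hπ _) hγ, C.ev_γp, mul_zero, zero_mul]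

end OverS

/-! ### The Hensel chart `D₀` -/

section D0

variable (e : ℕ) {j : ℕ} (hj : C.jH ≤ j) (hje : C.bp + e + 2 * C.Na ≤ j)

/-- The étale pair of the Hensel chart: `(p_new, p_new′ · (p_new − p_new(0))/Z)`; inverting the
second factor `(p_new − p_new(0))/Z = 1 + Z(…)` is what makes `Z` small (it selects the sheet of
the root close to `y`). [folklore] -/
abbrev PD : EtalePair (C.A'' hj) :=
  EtalePair.ofDerivativeMul (C.pnewS e hj hje) (C.pnewS e hj hje).divX

/-- **The Hensel chart** `D₀ = (A″_j[Z]/(p_new))[1/(p_new′ · (p_new − p_new(0))/Z)]` — the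
explicit étale `A″_j`-algebra in which `p` acquires the root `ζ = y + δ Z` close to `y` (the
finite-level form of Hensel's lemma in the completion). [folklore] -/
abbrev D₀ : Type u := (C.PD e hj hje).Ring

/-- `A″_j → m°` — the value at the point as an algebra structure on `O`. [folklore] -/
abbrev algO : Algebra (C.A'' hj) O :=
  (evRingHom φ (C.A'' hj) (fun _ hz => C.A''_subset_Rx hj hz) (fun _ hz => C.ev_mem_O_of_mem_A'' hj hz)).toAlgebra

/-- The `O`-point of the Hensel chart: `Z ↦ 0` satisfies `p_new(0)(x) = 0`, `p_new′(0)(x) = 1`,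
`((p_new − p_new(0))/Z)(0)(x) = 1`. [folklore] -/
theorem hasMap_zero : letI := C.algO hj
    (C.PD e hj hje).HasMap (0 : O) := by
  letI := C.algO hj
  rw [PD, EtalePair.hasMap_ofDerivativeMul_iff]
  refine ⟨?_, ?_, ?_⟩
  · rw [Polynomial.aeval_def, Polynomial.eval₂_at_zero]
    apply Subtype.ext
    exact C.ev_coeff_pnewS_zero e hj hje
  · rw [Polynomial.aeval_def, Polynomial.eval₂_at_zero, Polynomial.coeff_derivative,
      C.coeff_pnewS_one e hj hje]
    simp
  · rw [Polynomial.aeval_def, Polynomial.eval₂_at_zero, Polynomial.coeff_divX, zero_add,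
      C.coeff_pnewS_one e hj hje, map_one]
    exact isUnit_one

/-- The `O`-point `σ_D : D₀ → m°` of the Hensel chart. [folklore] -/
def σD : letI := C.algO hj; C.D₀ e hj hje →ₐ[C.A'' hj] O :=
  letI := C.algO hj
  (C.PD e hj hje).lift (0 : O) (C.hasMap_zero e hj hje)

/-- The point `r_D` of the Hensel chart over the centre of `m°`. [folklore] -/
def rD : Ideal (C.D₀ e hj hje) :=
  letI := C.algO hj
  (IsLocalRing.maximalIdeal O).comap (C.σD e hj hje).toRingHom

/-- `r_D` is prime. [folklore] -/
instance rD_isPrime : (C.rD e hj hje).IsPrime := by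
  unfold rD; exact Ideal.comap_isPrime _ _

/-- The Hensel variable `Z ∈ D₀`. [folklore] -/
abbrev Z : C.D₀ e hj hje := (C.PD e hj hje).X

/-- The Hensel root `ζ = y + δ Z ∈ D₀`. [folklore] -/
def ζ : C.D₀ e hj hje :=
  algebraMap (C.A'' hj) (C.D₀ e hj hje) (C.yS hj) +
    algebraMap (C.A'' hj) (C.D₀ e hj hje) (C.δS e hj) * C.Z e hj hje

/-- **`ζ` is a root of `p`** in the Hensel chart: `p(ζ) ι² = π^{e+2N_a} p_new(Z) = 0` and `ι` is
a non-zero-divisor of the flat `A″_j`-algebra `D₀`. [folklore] -/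
theorem aeval_ζ_pS : Polynomial.aeval (C.ζ e hj hje) (C.pS hj) = 0 := by
  have hX : Polynomial.aeval (C.Z e hj hje) (C.pnewS e hj hje) = 0 := (C.PD e hj hje).hasMap_X.1
  have hid := congrArg (Polynomial.aeval (C.Z e hj hje)) (C.C_mul_pnewS e hj hje)
  rw [map_mul, Polynomial.aeval_C, hX, mul_zero, map_mul, Polynomial.aeval_C,
    Polynomial.aeval_comp, map_add, Polynomial.aeval_C, map_mul, Polynomial.aeval_C,
    Polynomial.aeval_X] at hid
  -- `hid : 0 = ι² * p(ζ)`; cancel the non-zero-divisor `ι²`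
  have hι0 : C.ιS hj ^ 2 ≠ 0 := pow_ne_zero 2 (fun h0 => by
    have : C.ι hj = 0 := congrArg Subtype.val h0
    have h2 := C.ay_mul_ι hj
    rw [this, mul_zero] at h2
    exact pow_ne_zero _ C.πK_ne_zero h2.symm)
  have hreg : IsSMulRegular (C.D₀ e hj hje) (algebraMap (C.A'' hj) (C.D₀ e hj hje) (C.ιS hj ^ 2)) :=
    IsSMulRegular.of_flat (isLeftRegular_iff.mp (IsRegular.of_ne_zero hι0).left)
  refine hreg ?_
  simp only [smul_eq_mul, mul_zero]
  exact hid.symm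

/-- **`Z` is small**: `Z = −p_new(0) · ((p_new − p_new(0))/Z)(Z)⁻¹ ∈ π^{j−b_p−e−2N_a} D₀`.
[folklore] -/
theorem Z_small : ∃ d : C.D₀ e hj hje,
    C.Z e hj hje = algebraMap (C.A'' hj) (C.D₀ e hj hje) (C.πS hj ^ (j - C.bp - e - 2 * C.Na)) * d := by
  set P := C.PD e hj hje
  have hX : Polynomial.aeval (C.Z e hj hje) (C.pnewS e hj hje) = 0 := P.hasMap_X.1
  have hu : IsUnit (Polynomial.aeval (C.Z e hj hje) (C.pnewS e hj hje).divX) :=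
    ((EtalePair.hasMap_ofDerivativeMul_iff _ _ _).mp P.hasMap_X).2.2
  -- `Z · divX(p_new)(Z) + p_new(0) = p_new(Z) = 0`
  have key := congrArg (Polynomial.aeval (C.Z e hj hje)) (Polynomial.X_mul_divX_add (C.pnewS e hj hje))
  rw [hX, map_add, map_mul, Polynomial.aeval_X, Polynomial.aeval_C] at key
  -- the constant coefficient is `π^{j-bp-e-2Na} · (γ_p ι²)`
  have hc : (C.pnewS e hj hje).coeff 0 = C.πS hj ^ (j - C.bp - e - 2 * C.Na) *
      ⟨C.γp hj * C.ι hj ^ 2, Subring.mul_mem _ (C.A''₀_le_A'' hj (C.γp_mem_A''₀ hj))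
        (Subring.pow_mem _ (C.ι_mem_A'' hj) _)⟩ := by
    apply Subtype.ext
    rw [C.coeff_pnewS_zero_val e hj hje]
    simp only [Subring.coe_mul, SubmonoidClass.coe_pow, πS, mul_assoc]
  refine ⟨-(algebraMap (C.A'' hj) (C.D₀ e hj hje) ⟨C.γp hj * C.ι hj ^ 2, Subring.mul_mem _
    (C.A''₀_le_A'' hj (C.γp_mem_A''₀ hj)) (Subring.pow_mem _ (C.ι_mem_A'' hj) _)⟩ * ↑(hu.unit⁻¹)), ?_⟩
  obtain ⟨v, hv⟩ := hu
  have hZ : C.Z e hj hje = -(algebraMap (C.A'' hj) (C.D₀ e hj hje) ((C.pnewS e hj hje).coeff 0)) *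
      ↑(v⁻¹) := by
    have := eq_neg_of_add_eq_zero_left key
    rw [← this, mul_assoc, ← hv, Units.mul_inv, mul_one]
  have hunit : (IsUnit.unit ⟨v, hv⟩)⁻¹ = v⁻¹ := by
    rw [inv_inj]; exact Units.ext (by simp [hv])
  rw [hunit]
  nth_rewrite 1 [hZ]
  rw [hc, map_mul]; ring

/-! ### The point of the Hensel chart as a ring homomorphism -/

/-- `σ_D` as a ring homomorphism. [folklore] -/
def σDr : C.D₀ e hj hje →+* O :=
  letI := C.algO hj
  (C.σD e hj hje).toRingHom

/-- `σ_D(Z) = 0`. [folklore] -/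
@[simp] theorem σDr_Z : C.σDr e hj hje (C.Z e hj hje) = 0 := by
  letI := C.algO hj
  change (C.PD e hj hje).lift (0 : O) (C.hasMap_zero e hj hje) (C.PD e hj hje).X = 0
  exact (C.PD e hj hje).lift_X (0 : O) (C.hasMap_zero e hj hje)

/-- `σ_D` on `A″_j`: the value at the point. [folklore] -/
theorem σDr_algebraMap (a : C.A'' hj) :
    (C.σDr e hj hje (algebraMap (C.A'' hj) (C.D₀ e hj hje) a) : m) = ev φ (a : K) := by
  letI := C.algO hj
  have := ((C.PD e hj hje).lift (0 : O) (C.hasMap_zero e hj hje)).commutes a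
  change (((C.PD e hj hje).lift (0 : O) (C.hasMap_zero e hj hje)
    (algebraMap (C.A'' hj) (C.D₀ e hj hje) a) : O) : m) = _
  rw [this]; rfl

/-- `σ_D(ζ) = y₀`. [folklore] -/
theorem σDr_ζ : (C.σDr e hj hje (C.ζ e hj hje) : m) = C.y₀ := by
  rw [ζ, map_add, map_mul, σDr_Z, mul_zero, add_zero, σDr_algebraMap]; rfl

end D0

end DecompChart

end Literature.AlgebraicGeometry.Resolution
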